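import Summits.NavierStokesRegularity.NavierStokesRegularity.Theorems.SoloInformedResonantGerm

/-!
# Two-variable shear germs: every 'mixed' resonance with a vanishing index is realised

Solo seat `solo-NavierStokesRegularity-informed` (session 8; note `paper/incoming-stagnation.md` §4c,
EXTENSION of EXAMPLE E). Continuation of `SoloInformedResonantGerm`: there the polynomial pair
`U = (a₁ y₀, a₂ y₁ + s y₀^{m+1}, a₃ y₂)`, `P = Σ q_k y_k²` was shown to solve the self-similar Euler
profile equation
    `(1 - γ) U + γ (y·∇) U + (U·∇) U + ∇P = 0`                                                  (PE)
identically on the resonance line `ν₃ - m ν₁ = 1 + γ` (resonances of Theorem B of 'transversal' type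
`α = m e_k`, `k ≠ i`). Here the same is done for the TWO-VARIABLE shear
    `U = (a₁ y₀, a₂ y₁, a₃ y₂ + s · y₀^{p+1} y₁^{q+1})`,  `P = q₁ y₀² + q₂ y₁² + q₃ y₂²`, `2 q_k = -(a_k + a_k²)`:
(PE) holds identically iff `(1 - γ) + (p+1)(γ + a₁) + (q+1)(γ + a₂) + a₃ = 0`
(`biShearGerm_profileResidual_eq_zero`); the divergence is `a₁ + a₂ + a₃` (`biShearGerm_divergence`);
the vorticity is `s y₀^p y₁^q ((q+1) y₀, -(p+1) y₁, 0)` (`biShearGerm_curl`), of order exactly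
`m = p + q + 1` at the node; and in the spectral variables `ν_k = γ + a_k` (with `Σ ν = 3γ` from
`div U = 0`) the linear relation is `1 + γ + p ν₁ + q ν₂ = 0`, which is Theorem B's resonance (Res_m)
SIMULTANEOUSLY for `(i, α) = (1, (p+1, q, 0))` and `(2, (p, q+1, 0))` (`biShearGerm_resonance`) — the
'mixed' resonances whose reduced index `δ = α - e_i = (p, q, 0) ≥ 0` has a vanishing entry. Together
with `SoloInformedResonantGerm` (and permutations of the axes) this realises, by entire polynomial local
solutions of (PE) with vorticity of the exact resonant order, EVERY resonance `(i, α)` of Theorem B whose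
multi-index vanishes in some index `j ≠ i` (all resonances of orders `m ≤ 1`; for `m = 2` all but
`ν_i = (1 + 4γ)/2`). At such a node the in-plane rates satisfy `(p + q) · max(-ν₁, -ν₂) ≥ 1 + γ`
(`biShearGerm_rate`), far inside Theorem B's incoming bound. Paper-level meaning as in the parent file:
Theorem B is sharp as a pointwise statement; further necessary conditions on window profiles must be
global. Elementary polynomial identities; claimed only as a remark.
-/

namespace Summit.NavierStokesRegularity.NavierStokesRegularity.Theorems

open MvPolynomial

noncomputable section

/-- The nine first partial derivatives of the coordinate polynomials (bookkeeping for `simp only`;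
the parent file's copy is private). -/
private theorem dX' :
    pderiv 0 (X 0 : MvPolynomial (Fin 3) ℝ) = 1 ∧ pderiv 0 (X 1 : MvPolynomial (Fin 3) ℝ) = 0 ∧
    pderiv 0 (X 2 : MvPolynomial (Fin 3) ℝ) = 0 ∧ pderiv 1 (X 0 : MvPolynomial (Fin 3) ℝ) = 0 ∧
    pderiv 1 (X 1 : MvPolynomial (Fin 3) ℝ) = 1 ∧ pderiv 1 (X 2 : MvPolynomial (Fin 3) ℝ) = 0 ∧
    pderiv 2 (X 0 : MvPolynomial (Fin 3) ℝ) = 0 ∧ pderiv 2 (X 1 : MvPolynomial (Fin 3) ℝ) = 0 ∧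
    pderiv 2 (X 2 : MvPolynomial (Fin 3) ℝ) = 1 :=
  ⟨pderiv_X_self 0, pderiv_X_of_ne (by decide), pderiv_X_of_ne (by decide), pderiv_X_of_ne (by decide),
    pderiv_X_self 1, pderiv_X_of_ne (by decide), pderiv_X_of_ne (by decide), pderiv_X_of_ne (by decide),
    pderiv_X_self 2⟩

/-! ### The two-variable shear germ -/

/-- `U = (a₁ y₀, a₂ y₁, a₃ y₂ + s y₀^{p+1} y₁^{q+1})`. -/
def biShearGermU (a₁ a₂ a₃ s : ℝ) (p q : ℕ) : Fin 3 → MvPolynomial (Fin 3) ℝ :=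
  ![C a₁ * X 0, C a₂ * X 1, C a₃ * X 2 + C s * (X 0 ^ (p + 1) * X 1 ^ (q + 1))]

/-- The three components of `biShearGermU`, by `rfl` (for rewriting under `simp only`). -/
private theorem biShearGermU_apply (a₁ a₂ a₃ s : ℝ) (p q : ℕ) :
    biShearGermU a₁ a₂ a₃ s p q 0 = C a₁ * X 0 ∧
    biShearGermU a₁ a₂ a₃ s p q 1 = C a₂ * X 1 ∧
    biShearGermU a₁ a₂ a₃ s p q 2 = C a₃ * X 2 + C s * (X 0 ^ (p + 1) * X 1 ^ (q + 1)) :=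
  ⟨rfl, rfl, rfl⟩

/-- **The two-variable shear germ solves (PE).** With `2 q_k = -(a_k + a_k²)` and the single linear
relation `(1 - γ) + (p+1)(γ + a₁) + (q+1)(γ + a₂) + a₃ = 0` (the resonance, see `biShearGerm_resonance`),
all three components of the profile residual vanish identically. -/
theorem biShearGerm_profileResidual_eq_zero {γ a₁ a₂ a₃ s q₁ q₂ q₃ : ℝ} {p q : ℕ}
    (hq₁ : 2 * q₁ + a₁ + a₁ ^ 2 = 0) (hq₂ : 2 * q₂ + a₂ + a₂ ^ 2 = 0)
    (hq₃ : 2 * q₃ + a₃ + a₃ ^ 2 = 0)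
    (hres : (1 - γ) + (p + 1) * (γ + a₁) + (q + 1) * (γ + a₂) + a₃ = 0) (i : Fin 3) :
    profileResidual γ (biShearGermU a₁ a₂ a₃ s p q) (diagQuadP q₁ q₂ q₃) i = 0 := by
  have Hq₁ : (2 : MvPolynomial (Fin 3) ℝ) * C q₁ + C a₁ + C a₁ ^ 2 = 0 := by
    have h := congrArg (C : ℝ →+* MvPolynomial (Fin 3) ℝ) hq₁
    simpa [map_add, map_mul, map_pow, map_ofNat] using h
  have Hq₂ : (2 : MvPolynomial (Fin 3) ℝ) * C q₂ + C a₂ + C a₂ ^ 2 = 0 := by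
    have h := congrArg (C : ℝ →+* MvPolynomial (Fin 3) ℝ) hq₂
    simpa [map_add, map_mul, map_pow, map_ofNat] using h
  have Hq₃ : (2 : MvPolynomial (Fin 3) ℝ) * C q₃ + C a₃ + C a₃ ^ 2 = 0 := by
    have h := congrArg (C : ℝ →+* MvPolynomial (Fin 3) ℝ) hq₃
    simpa [map_add, map_mul, map_pow, map_ofNat] using h
  have Hres : ((1 : MvPolynomial (Fin 3) ℝ) - C γ) + ((p : MvPolynomial (Fin 3) ℝ) + 1) * (C γ + C a₁)
      + ((q : MvPolynomial (Fin 3) ℝ) + 1) * (C γ + C a₂) + C a₃ = 0 := by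
    have h := congrArg (C : ℝ →+* MvPolynomial (Fin 3) ℝ) hres
    simpa [map_add, map_sub, map_mul, map_natCast] using h
  obtain ⟨d00, d01, d02, d10, d11, d12, d20, d21, d22⟩ := dX'
  obtain ⟨u0, u1, u2⟩ := biShearGermU_apply a₁ a₂ a₃ s p q
  have r0 : profileResidual γ (biShearGermU a₁ a₂ a₃ s p q) (diagQuadP q₁ q₂ q₃) 0 = 0 := by
    simp only [profileResidual, u0, u1, u2, diagQuadP, map_add, map_sub, map_one,
      pderiv_mul, pderiv_pow, pderiv_C, d00, d01, d02, d10, d20]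
    push_cast
    linear_combination (X 0 : MvPolynomial (Fin 3) ℝ) * Hq₁
  have r1 : profileResidual γ (biShearGermU a₁ a₂ a₃ s p q) (diagQuadP q₁ q₂ q₃) 1 = 0 := by
    simp only [profileResidual, u0, u1, u2, diagQuadP, map_add, map_sub, map_one,
      pderiv_mul, pderiv_pow, pderiv_C, d01, d10, d11, d12, d21]
    push_cast
    linear_combination (X 1 : MvPolynomial (Fin 3) ℝ) * Hq₂
  have r2 : profileResidual γ (biShearGermU a₁ a₂ a₃ s p q) (diagQuadP q₁ q₂ q₃) 2 = 0 := by
    simp only [profileResidual, u0, u1, u2, diagQuadP, map_add, map_sub, map_one,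
      pderiv_mul, pderiv_pow, pderiv_C, d00, d01, d02, d10, d11, d12, d20, d21, d22, Nat.add_sub_cancel]
    push_cast
    linear_combination (X 2 : MvPolynomial (Fin 3) ℝ) * Hq₃ +
      (C s * (X 0 ^ (p + 1) * X 1 ^ (q + 1)) : MvPolynomial (Fin 3) ℝ) * Hres
  fin_cases i
  exacts [r0, r1, r2]

/-- Divergence of the two-variable shear germ: `a₁ + a₂ + a₃` (the shear is divergence-free). -/
theorem biShearGerm_divergence (a₁ a₂ a₃ s : ℝ) (p q : ℕ) :
    polyDiv (biShearGermU a₁ a₂ a₃ s p q) = C (a₁ + a₂ + a₃) := by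
  obtain ⟨d00, -, -, -, d11, -, d20, d21, d22⟩ := dX'
  obtain ⟨u0, u1, u2⟩ := biShearGermU_apply a₁ a₂ a₃ s p q
  simp only [polyDiv, u0, u1, u2, map_add, pderiv_mul, pderiv_pow, pderiv_C, d00, d11, d20, d21, d22]
  ring

/-- Vorticity of the two-variable shear germ: `Ω = s y₀^p y₁^q ((q+1) y₀, -(p+1) y₁, 0)`, of order exactly
`m = p + q + 1` at the node, with `Ω¹ ∋ y^{(p+1, q, 0)}` and `Ω² ∋ y^{(p, q+1, 0)}`. -/
theorem biShearGerm_curl (a₁ a₂ a₃ s : ℝ) (p q : ℕ) :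
    polyCurl₁ (biShearGermU a₁ a₂ a₃ s p q) = ((q : MvPolynomial (Fin 3) ℝ) + 1) * C s * (X 0 ^ (p + 1) * X 1 ^ q) ∧
    polyCurl₂ (biShearGermU a₁ a₂ a₃ s p q) = -(((p : MvPolynomial (Fin 3) ℝ) + 1) * C s * (X 0 ^ p * X 1 ^ (q + 1))) ∧
    polyCurl₃ (biShearGermU a₁ a₂ a₃ s p q) = 0 := by
  obtain ⟨d00, d01, d02, d10, d11, d12, d20, d21, -⟩ := dX'
  obtain ⟨u0, u1, u2⟩ := biShearGermU_apply a₁ a₂ a₃ s p q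
  refine ⟨?_, ?_, ?_⟩
  · simp only [polyCurl₁, u1, u2, map_add, pderiv_mul, pderiv_pow, pderiv_C, d10, d11, d12, d21,
      Nat.add_sub_cancel]
    push_cast
    ring
  · simp only [polyCurl₂, u0, u2, map_add, pderiv_mul, pderiv_pow, pderiv_C, d00, d01, d02, d20,
      Nat.add_sub_cancel]
    push_cast
    ring
  · simp only [polyCurl₃, u0, u1, pderiv_mul, pderiv_C, d01, d10]
    ring

/-- The node: all three components of `V = γ y + U` vanish at `y = 0` (no constant terms). -/
theorem biShearGerm_node (γ a₁ a₂ a₃ s : ℝ) (p q : ℕ) (i : Fin 3) :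
    constantCoeff (C γ * X i + biShearGermU a₁ a₂ a₃ s p q i) = 0 := by
  obtain ⟨u0, u1, u2⟩ := biShearGermU_apply a₁ a₂ a₃ s p q
  fin_cases i
  · simp [u0, constantCoeff_X]
  · simp [u1, constantCoeff_X]
  · simp [u2, constantCoeff_X]

/-- **The linear relation is a double resonance.** In the spectral variables `ν_k = γ + a_k` of
`∇V(0) = diag(ν)`, `div U = 0` and the relation of `biShearGerm_profileResidual_eq_zero` say:
`Σ ν = 3γ` and `1 + γ + p ν₁ + q ν₂ = 0`, which is Theorem B's resonance `ν_i - α·ν = 1 + γ` both for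
`(i, α) = (1, (p+1, q, 0))` and for `(i, α) = (2, (p, q+1, 0))` — the two monomials carried by the
vorticity `biShearGerm_curl` (order `m = p + q + 1`). -/
theorem biShearGerm_resonance {γ a₁ a₂ a₃ ν₁ ν₂ ν₃ : ℝ} {p q : ℕ} (hν₁ : ν₁ = γ + a₁) (hν₂ : ν₂ = γ + a₂)
    (hν₃ : ν₃ = γ + a₃) (hdiv : a₁ + a₂ + a₃ = 0)
    (hres : (1 - γ) + (p + 1) * (γ + a₁) + (q + 1) * (γ + a₂) + a₃ = 0) :
    ν₁ + ν₂ + ν₃ = 3 * γ ∧ 1 + γ + p * ν₁ + q * ν₂ = 0 ∧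
      ν₁ - ((p + 1) * ν₁ + q * ν₂ + 0 * ν₃) = 1 + γ ∧ ν₂ - (p * ν₁ + (q + 1) * ν₂ + 0 * ν₃) = 1 + γ := by
  subst hν₁ hν₂ hν₃
  refine ⟨by linarith, ?_, ?_, ?_⟩
  · linear_combination hres - hdiv
  · linear_combination hdiv - hres
  · linear_combination hdiv - hres

/-- Conversely every point of the resonance plane `1 + γ + p ν₁ + q ν₂ = 0` is realised: put
`a₁ = ν₁ - γ`, `a₂ = ν₂ - γ`, `a₃ = 2γ - ν₁ - ν₂`; then `div U = 0` and the linear relation holds. -/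
theorem biShearGerm_realises {γ ν₁ ν₂ : ℝ} {p q : ℕ} (h : 1 + γ + p * ν₁ + q * ν₂ = 0) :
    (ν₁ - γ) + (ν₂ - γ) + (2 * γ - ν₁ - ν₂) = 0 ∧
      (1 - γ) + (p + 1) * (γ + (ν₁ - γ)) + (q + 1) * (γ + (ν₂ - γ)) + (2 * γ - ν₁ - ν₂) = 0 := by
  refine ⟨by ring, ?_⟩
  linear_combination h

/-- **Incoming, quantitatively.** On the resonance plane, if both in-plane rates are `≥ -r` then
`(p + q) r ≥ 1 + γ`: for `p + q ≥ 1` the node is incoming with rate at least `(1+γ)/(p+q)`, far inside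
Theorem B's bound `(1 - 2γ)/(m + 2)`, `m = p + q + 1` (and `p = q = 0` is impossible for `γ > -1`). -/
theorem biShearGerm_rate {γ r ν₁ ν₂ : ℝ} {p q : ℕ} (h : 1 + γ + p * ν₁ + q * ν₂ = 0) (h₁ : -r ≤ ν₁)
    (h₂ : -r ≤ ν₂) : 1 + γ ≤ (p + q) * r := by
  have hp : (0 : ℝ) ≤ p := Nat.cast_nonneg p
  have hq : (0 : ℝ) ≤ q := Nat.cast_nonneg q
  nlinarith [mul_le_mul_of_nonneg_left h₁ hp, mul_le_mul_of_nonneg_left h₂ hq]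

/-- No resonance of this family at order `m = 1` (`p = q = 0`) when `γ ≠ -1`; the family starts at `m = 2`. -/
theorem biShearGerm_order_two_le {γ ν₁ ν₂ : ℝ} (h : 1 + γ + (0 : ℕ) * ν₁ + (0 : ℕ) * ν₂ = 0) : γ = -1 := by
  push_cast at h
  linarith

/-- Window instance: `γ = 2/5`, `p = 1`, `q = 0` (`m = 2`, `δ = (1,0,0)`): `ν₁ = -(1+γ) = -7/5`, e.g.
`ν = (-7/5, 3/5, 2)` — trace `6/5 = 3γ`, a saddle, and Theorem B's bound `-(1-2γ)/4 = -1/20` holds with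
room to spare. -/
example : (1 : ℝ) + 2/5 + 1 * (-7/5) + 0 * (3/5) = 0 ∧ (-7/5 : ℝ) + 3/5 + 2 = 3 * (2/5) ∧
    (-7/5 : ℝ) ≤ -((1 - 2 * (2/5)) / (2 + 2)) := by norm_num

end

end Summit.NavierStokesRegularity.NavierStokesRegularity.Theorems
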